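import Literature.NumberTheory.DiophantineGeometry.PastenValuationProducts
import Literature.NumberTheory.DiophantineGeometry.ValuationProductElliptic
import Literature.NumberTheory.EllipticCurves.PastenValuationProduct
import Literature.NumberTheory.DiophantineGeometry.ConductorExponentZeroProofs
import Literature.NumberTheory.DiophantineGeometry.ConductorMultiplicativeProofs
import Literature.NumberTheory.DiophantineGeometry.ConductorFactorizationProofs
import HarnessLib

/-!
# Pasten's products of valuations: the three vendorings of Theorem 16.5 agree

H. Pasten, *Shimura curves and the abc conjecture*, J. Number Theory 254 (2024) 214–335
(arXiv:1705.09251), Theorem 1.12 = §16.3 Theorem 16.5 (arXiv numbering; held copy p. 50):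

> Let `ε > 0`. There is a number `K_ε > 0` depending only on `ε` such that the following holds:
> For every semi-stable elliptic curve `E` over `ℚ` we have `∏_{p ∣ N_E} v_p(Δ_E) < K_ε · N_E^{11/2+ε}`.
> If moreover `ε > 0` and `E` has at least `3 + 11/ε` places of bad reduction, then we have the
> stronger estimate `∏_{p ∣ N_E} v_p(Δ_E) < K_ε · N_E^{8/3+ε}`.

The tree states this theorem as named facts (`def … : Prop`, unproved) THREE times, over two
renderings of "semi-stable":

* `Literature.NumberTheory.DiophantineGeometry.pasten_valuationProduct_semistable` /
  `…_manyPrimes` / `pasten_valuationProduct_awayFrom` (`PastenValuationProducts.lean`):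
  semi-stable = `W.IsSemistable ℤ` (good or multiplicative reduction at every finite place,
  `LocalReduction`);
* `Literature.NumberTheory.DiophantineGeometry.pastenShimura2024_thm_1_12` /
  `pastenShimura2024_thm_16_5_manyPrimes` / `pastenShimura2024_cor_16_2`
  (`ValuationProductElliptic.lean`): semi-stable = `Squarefree (W.conductorNorm ℤ)`;
* `Literature.NumberTheory.EllipticCurves.pasten_thm_1_12` (`EllipticCurves/PastenValuationProduct.lean`):
  both displays in ONE statement with a common constant `K_ε`, semi-stable = `W.IsSemistable ℤ`.

This file proves, sorry-free and without any new definition, that these are the same statements,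
so that a single future discharge of any one of them discharges all:

* `WeierstrassCurve.isSemistable_iff_squarefree_conductorNorm` — for an elliptic curve `W / ℚ`,
  `W.IsSemistable ℤ ↔ Squarefree (W.conductorNorm ℤ)`: semistable at `v` iff `f_v ≤ 1`
  (Silverman, ATAEC IV.10.2 (a),(b): `f_v = 0` iff good, `f_v = 1` iff multiplicative reduction —
  the DISCHARGED named facts `WeierstrassCurve.conductorExponent_eq_zero_iff_holds`,
  `…_eq_one_iff_holds`), and `N_E = ∏_p p^{f_p}` (`WeierstrassCurve.factorization_conductorNorm_holds`),
  so `f_p ≤ 1` for all `p` iff `N_E` is squarefree (`Nat.squarefree_iff_factorization_le_one`);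
* `pasten_valuationProduct_semistable_iff_pastenShimura2024_thm_1_12`,
  `pasten_valuationProduct_semistable_manyPrimes_iff_pastenShimura2024_thm_16_5_manyPrimes`,
  `pasten_valuationProduct_awayFrom_iff_pastenShimura2024_cor_16_2` — the `Iff`s between the
  first two vendorings;
* `pasten_thm_1_12_iff_valuationProduct` — the third vendoring is the conjunction of the two parts
  (common constant: take `K_ε = max (K_ε', K_ε'')`);
* the one-way corollaries `pasten_valuationProduct_semistable_manyPrimes_of_pastenShimura2024_thm_16_5_manyPrimes`
  and `pasten_valuationProduct_semistable_manyPrimes_of_pasten_thm_1_12`, the form in which a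
  discharge of either duplicate yields `pasten_valuationProduct_semistable_manyPrimes`.

What is NOT here: a proof of Theorem 16.5 itself. Its printed proof (§16.3 from Theorem 16.4 (i),
itself the proof of Theorem 16.1 with the refined Ribet–Takahashi formula) rests on the modularity
of semistable elliptic curves over `ℚ`, Shimura-curve parametrisations `X_0^D(M) → E`
(Jacquet–Langlands), Arakelov-theoretic lower bounds for the degrees `δ_{D,M}` (§§9–14 of the
paper), the congruence-number upper bound for `δ_{1,N}` and the Manin constant — none of which is
available in Mathlib or in `Literature/` — so the three facts stay named facts. Remark on the
printed proof: it establishes the second display for `n > 3 + 11/ε` bad places (strictly; the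
averaging over the `n` cyclic triples `M_j = p_j p_{j+1} p_{j+2}` gives the exponent
`8/3 + 11/(n-3) + ε'·n/(n-3)`), and for every even `n ≥ 4`; the statements above transcribe the
printed "at least `3 + 11/ε`" verbatim.

## References

* [PastenShimura2024] H. Pasten, *Shimura curves and the abc conjecture*, J. Number Theory 254
  (2024) 214–335, doi:10.1016/j.jnt.2023.07.002, arXiv:1705.09251 — Thm 1.12, §16.3 Thm 16.5,
  §16.1 Cor 16.2 (arXiv numbering; p. 50 of the held copy).
* [Silverman1994] J. H. Silverman, *Advanced Topics in the Arithmetic of Elliptic Curves*, GTM 151,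
  1994, Thm IV.10.2.
-/

noncomputable section

open IsDedekindDomain Rat.HeightOneSpectrum

namespace WeierstrassCurve

/-- **Semistable iff squarefree conductor** (elliptic curves over `ℚ`): `W / ℚ` has good or
multiplicative reduction at every prime iff its conductor `N_E = W.conductorNorm ℤ` is squarefree.
Proof: semistable at `v` iff `f_v ≤ 1` (`f_v = 0` iff good, `f_v = 1` iff multiplicative
reduction, Silverman ATAEC IV.10.2 (a),(b), the discharged named facts
`conductorExponent_eq_zero_iff_holds`, `conductorExponent_eq_one_iff_holds`, combined in
`isSemistable_iff_conductorExponent_le_one`); `N_E = ∏_p p ^ {f_p}`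
(`factorization_conductorNorm_holds`), every rational prime being `p_v` for a unique place `v` of
`ℤ` (`Rat.HeightOneSpectrum.primesEquiv`); and a positive integer is squarefree iff all exponents
of its factorisation are `≤ 1` (`Nat.squarefree_iff_factorization_le_one`, `N_E > 0` by
`conductorNorm_pos_holds`). (Deliberate dot-notation extension of the Mathlib namespace
`WeierstrassCurve`, as in `Conductor`.) [cite: Silverman1994, IV.10.2] -/
theorem isSemistable_iff_squarefree_conductorNorm (W : WeierstrassCurve ℚ) [W.IsElliptic] :
    W.IsSemistable ℤ ↔ Squarefree (W.conductorNorm ℤ) := by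
  rw [W.isSemistable_iff_conductorExponent_le_one ℤ
      (fun v ↦ conductorExponent_eq_zero_iff_holds v W)
      (fun v ↦ conductorExponent_eq_one_iff_holds v W),
    Nat.squarefree_iff_factorization_le_one (W.conductorNorm_pos_holds).ne']
  constructor
  · intro h p
    by_cases hp : p.Prime
    · have hgen : natGenerator ((primesEquiv (R := ℤ)).symm ⟨p, hp⟩) = p :=
        congrArg (fun q : Nat.Primes ↦ (q : ℕ)) ((primesEquiv (R := ℤ)).apply_symm_apply ⟨p, hp⟩)
      have hv := h ((primesEquiv (R := ℤ)).symm ⟨p, hp⟩)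
      rwa [← factorization_conductorNorm_holds W ((primesEquiv (R := ℤ)).symm ⟨p, hp⟩), hgen] at hv
    · rw [Nat.factorization_eq_zero_of_not_prime _ hp]
      exact zero_le_one
  · intro h v
    rw [← factorization_conductorNorm_holds W v]
    exact h _

end WeierstrassCurve

namespace Literature.NumberTheory.DiophantineGeometry

/-- For a squarefree conductor the two products of the tree coincide:
`valuationProduct W = ∏_{p ∣ N_E} v_p(Δ_E)` equals
`multiplicativeValuationProduct W = ∏_{p ∣ N_E, p² ∤ N_E} v_p(Δ_E)` (every `p ∣ N_E` has
`p² ∤ N_E`). [folklore] -/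
theorem valuationProduct_eq_multiplicativeValuationProduct_of_squarefree (W : WeierstrassCurve ℚ)
    (h : Squarefree (W.conductorNorm ℤ)) :
    valuationProduct W = multiplicativeValuationProduct W := by
  rw [multiplicativeValuationProduct_eq_of_squarefree W h, valuationProduct_def]

/-- **Pasten, Theorem 1.12 — the two vendorings agree.** The named fact
`pasten_valuationProduct_semistable` (semi-stable as `W.IsSemistable ℤ`) is equivalent to
`pastenShimura2024_thm_1_12` (semi-stable as `Squarefree (W.conductorNorm ℤ)`), by
`WeierstrassCurve.isSemistable_iff_squarefree_conductorNorm`; the two conclusions are literally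
the same inequality (`valuationProduct_def`). [cite: PastenShimura2024, Theorem 1.12] -/
theorem pasten_valuationProduct_semistable_iff_pastenShimura2024_thm_1_12 :
    pasten_valuationProduct_semistable ↔ pastenShimura2024_thm_1_12 := by
  constructor
  · intro h ε hε
    obtain ⟨K, hK, hW⟩ := h ε hε
    refine ⟨K, hK, fun W _ hsq ↦ ?_⟩
    simpa only [valuationProduct_def] using
      hW W ((W.isSemistable_iff_squarefree_conductorNorm).mpr hsq)
  · intro h ε hε
    obtain ⟨K, hK, hW⟩ := h ε hε
    refine ⟨K, hK, fun W _ hss ↦ ?_⟩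
    simpa only [valuationProduct_def] using
      hW W ((W.isSemistable_iff_squarefree_conductorNorm).mp hss)

/-- **Pasten, Theorem 16.5, second display (many bad primes) — the two vendorings agree.** The
named fact `pasten_valuationProduct_semistable_manyPrimes` (semi-stable as `W.IsSemistable ℤ`) is
equivalent to `pastenShimura2024_thm_16_5_manyPrimes` (semi-stable as
`Squarefree (W.conductorNorm ℤ)`), by `WeierstrassCurve.isSemistable_iff_squarefree_conductorNorm`;
hypotheses `3 + 11/ε ≤ #{p ∣ N_E}` and conclusions are literally the same.
[cite: PastenShimura2024, Theorem 16.5 (arXiv numbering), second part] -/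
theorem pasten_valuationProduct_semistable_manyPrimes_iff_pastenShimura2024_thm_16_5_manyPrimes :
    pasten_valuationProduct_semistable_manyPrimes ↔ pastenShimura2024_thm_16_5_manyPrimes := by
  constructor
  · intro h ε hε
    obtain ⟨K, hK, hW⟩ := h ε hε
    refine ⟨K, hK, fun W _ hsq hn ↦ ?_⟩
    simpa only [valuationProduct_def] using
      hW W ((W.isSemistable_iff_squarefree_conductorNorm).mpr hsq) hn
  · intro h ε hε
    obtain ⟨K, hK, hW⟩ := h ε hε
    refine ⟨K, hK, fun W _ hss hn ↦ ?_⟩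
    simpa only [valuationProduct_def] using
      hW W ((W.isSemistable_iff_squarefree_conductorNorm).mp hss) hn

/-- **Pasten, Corollary 16.2 — the two vendorings agree.** `pasten_valuationProduct_awayFrom` and
`pastenShimura2024_cor_16_2` are the same statement: both render "semi-stable away from `S`" as
`p² ∤ N_E` for primes `p ∉ S`, "`≥ 2` multiplicative primes" by the same filtered cardinality,
and the product over the multiplicative primes is `multiplicativeValuationProduct W` by
definition. [cite: PastenShimura2024, Corollary 16.2 (arXiv numbering)] -/
theorem pasten_valuationProduct_awayFrom_iff_pastenShimura2024_cor_16_2 :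
    pasten_valuationProduct_awayFrom ↔ pastenShimura2024_cor_16_2 := by
  constructor
  · intro h S ε hε
    obtain ⟨K, hK, hW⟩ := h S ε hε
    refine ⟨K, hK, fun W _ hS h2 ↦ ?_⟩
    simpa only [multiplicativeValuationProduct_def] using hW W hS h2
  · intro h S ε hε
    obtain ⟨K, hK, hW⟩ := h S ε hε
    refine ⟨K, hK, fun W _ hS h2 ↦ ?_⟩
    simpa only [multiplicativeValuationProduct_def] using hW W hS h2

/-- **Pasten, Theorem 1.12 / 16.5 — the third vendoring is the conjunction of the two parts.**
`Literature.NumberTheory.EllipticCurves.pasten_thm_1_12` states both displays of Theorem 16.5 with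
one constant `K_ε`; it is equivalent to `pasten_valuationProduct_semistable ∧
pasten_valuationProduct_semistable_manyPrimes` (for the converse take the common constant
`max K_ε' K_ε''`, using `N_E^{s} ≥ 0`). [cite: PastenShimura2024, Theorem 1.12 and Theorem 16.5] -/
theorem pasten_thm_1_12_iff_valuationProduct :
    Literature.NumberTheory.EllipticCurves.pasten_thm_1_12 ↔
      pasten_valuationProduct_semistable ∧ pasten_valuationProduct_semistable_manyPrimes := by
  constructor
  · intro h
    refine ⟨fun ε hε ↦ ?_, fun ε hε ↦ ?_⟩
    · obtain ⟨K, hK, h1, -⟩ := h ε hε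
      exact ⟨K, hK, fun W _ hss ↦ by simpa only [valuationProduct_def] using h1 W hss⟩
    · obtain ⟨K, hK, -, h2⟩ := h ε hε
      exact ⟨K, hK, fun W _ hss hn ↦ by simpa only [valuationProduct_def] using h2 W hss hn⟩
  · rintro ⟨h1, h2⟩ ε hε
    obtain ⟨K₁, hK₁, h1⟩ := h1 ε hε
    obtain ⟨K₂, hK₂, h2⟩ := h2 ε hε
    refine ⟨max K₁ K₂, lt_max_of_lt_left hK₁, fun W _ hss ↦ ?_, fun W _ hss hn ↦ ?_⟩
    · have h := h1 W hss
      rw [valuationProduct_def] at h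
      exact h.trans_le (mul_le_mul_of_nonneg_right (le_max_left _ _)
        (Real.rpow_nonneg (Nat.cast_nonneg _) _))
    · have h := h2 W hss hn
      rw [valuationProduct_def] at h
      exact h.trans_le (mul_le_mul_of_nonneg_right (le_max_right _ _)
        (Real.rpow_nonneg (Nat.cast_nonneg _) _))

/-- `pasten_valuationProduct_semistable_manyPrimes` from its duplicate
`pastenShimura2024_thm_16_5_manyPrimes` (one direction of
`pasten_valuationProduct_semistable_manyPrimes_iff_pastenShimura2024_thm_16_5_manyPrimes`): a
discharge of the latter discharges the former.
[cite: PastenShimura2024, Theorem 16.5 (arXiv numbering), second part] -/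
theorem pasten_valuationProduct_semistable_manyPrimes_of_pastenShimura2024_thm_16_5_manyPrimes
    (h : pastenShimura2024_thm_16_5_manyPrimes) : pasten_valuationProduct_semistable_manyPrimes :=
  pasten_valuationProduct_semistable_manyPrimes_iff_pastenShimura2024_thm_16_5_manyPrimes.mpr h

/-- `pasten_valuationProduct_semistable_manyPrimes` from the third vendoring
`Literature.NumberTheory.EllipticCurves.pasten_thm_1_12` (its second conjunct).
[cite: PastenShimura2024, Theorem 1.12 and Theorem 16.5] -/
theorem pasten_valuationProduct_semistable_manyPrimes_of_pasten_thm_1_12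
    (h : Literature.NumberTheory.EllipticCurves.pasten_thm_1_12) :
    pasten_valuationProduct_semistable_manyPrimes :=
  (pasten_thm_1_12_iff_valuationProduct.mp h).2

/-- `pasten_valuationProduct_semistable` (Theorem 1.12, first display) from the third vendoring
`Literature.NumberTheory.EllipticCurves.pasten_thm_1_12` (its first conjunct).
[cite: PastenShimura2024, Theorem 1.12] -/
theorem pasten_valuationProduct_semistable_of_pasten_thm_1_12
    (h : Literature.NumberTheory.EllipticCurves.pasten_thm_1_12) :
    pasten_valuationProduct_semistable :=
  (pasten_thm_1_12_iff_valuationProduct.mp h).1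

end Literature.NumberTheory.DiophantineGeometry

end
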